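import Literature.NumberTheory.EllipticCurves.ThetaDatumLevelTwo
import Literature.NumberTheory.EllipticCurves.TwoTorsionChordIdentities
import Mathlib.Algebra.CubicDiscriminant
import HarnessLib

/-!
# The Galois-free identities behind the isotropy of Kummer classes for the Poonen–Rains form at level `2`

Fix a field `F`, three distinct `e₀, e₁, e₂ ∈ F` (the abscissae of the nonzero `2`-torsion points
`T₀, T₁, T₂` of an elliptic curve `E/F`, roots of the `2`-division cubic `Ψ = 4∏(x − eᵢ)`),
`Dᵢ := (eᵢ − eᵢ₊₁)(eᵢ − eᵢ₊₂) = Ψ′(eᵢ)/4`, and a point `R ∈ E(F)` with abscissa `x_R ≠ eᵢ` (i.e.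
`2R ≠ O`).  By the chord identity (T1) of `TwoTorsionChordIdentities`
(`four_mul_sub_mul_addX_sub`), the translate `R + Tᵢ` has abscissa

  `x(R + Tᵢ) = eᵢ + Dᵢ/(x_R − eᵢ)`        (`addX_eq_of_roots`, from (T1) + Vieta `vieta_D`).

Write, for `v` in the frame `V = 𝔽₂²` (`v₀,v₁,v₂ ↔ T₀,T₁,T₂`, `0 ↔ O`), `A_R(v) := x_R − e_v` (`A_R(0) := 1`)
and `M(v, w)` for the theta-group table of `ThetaDatumLevelTwo` (`u_v u_w = M(v,w) u_{v+w}`: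
`M(vᵢ,vᵢ) = Dᵢ⁻¹`, `M(vᵢ,vⱼ) = (eᵢ − eⱼ)⁻¹`).  THE IDENTITY (`A_mul_A_mul_table`):

  `A_R(u) · A_{R+T_u}(w) · M(u, w) = A_R(u + w)`   for all `u, w ∈ V`,

i.e. the `Gm`-valued theta cocycle `M(ξ_σ, σξ_τ)` of a Kummer cocycle `ξ_σ = σR − R` is the coboundary
`A(στ)/(A(σ)·σA(τ))` of the `1`-cochain `A(σ) = x_R − e_{ξ_σ}` (since `σR = R + T_{ξ_σ}` and
`σ(x_R − e_{ξ_τ}) = x(R+T_{ξσ}) − e_{σξ_τ}`).  Together with the SIGN IDENTITY (`sq_eq_of_chord`):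
`(s_v/A_R(v))² · η(R)/η(R+T_v) = 1` for `s_v² = −D_v` (from (T1) and (Y):
`η(R+T)(x_R − e)² = −η(R) D`), this is the explicit splitting
`ℓ(σ) = s_{ξσ} β/((x_R − e_{ξσ}) σβ)`, `β² = η(R)`, of the `μ₂`-valued Poonen–Rains cocycle on Kummer
classes (O'Neil 2002 / Poonen–Rains 2012 Prop. 4.8: `q(δ(P)) = 0`), whose Galois bookkeeping is the
object of the sequel.  Everything here is identities in the field `F` (16-case analysis over `V`).

References: B. Poonen, E. Rains, JAMS 25 (2012), Prop. 4.8 (the image of `A(k)/λA(k)` is isotropic for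
`q`) [PoonenRains2012]; J. H. Silverman, *AEC* III.2.3 (group law), III.1 (`Ψ`) [SilvermanAEC2009].
No named fact is introduced.
-/

set_option autoImplicit false

noncomputable section

open scoped Classical

namespace Literature.NumberTheory.EllipticCurves

namespace ThetaLevelTwo

open Literature.NumberTheory.EllipticCurves.DokchitserDokchitser2012 (vec idx)
open WeierstrassCurve Polynomial

universe u

variable {F : Type u} [Field F]

/-! ### The theta table and the cochain `A_R` as functions of the three roots -/

/-- `Dᵢ(e) = (eᵢ − eᵢ₊₁)(eᵢ − eᵢ₊₂)`. [cite: SilvermanAEC2009, III.2.3 (translation by a 2-torsion point)] -/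
def Dof (e : Fin 3 → F) (i : Fin 3) : F := (e i - e (i + 1)) * (e i - e (i + 2))

/-- The theta-group table as a function of the roots: `M(O,·) = M(·,O) = 1`, `M(vᵢ,vᵢ) = Dᵢ⁻¹`,
`M(vᵢ,vⱼ) = (eᵢ − eⱼ)⁻¹`. [cite: PoonenRains2012, Prop. 4.5 (the Heisenberg group as a central extension)] -/
def tableOf (e : Fin 3 → F) (v w : V) : F :=
  if v = 0 ∨ w = 0 then 1 else if v = w then (Dof e (idx v))⁻¹ else (e (idx v) - e (idx w))⁻¹

/-- The table of a theta datum is `tableOf` of its roots. [cite: PoonenRains2012, Prop. 4.5 (the Heisenberg group as a central extension)] -/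
theorem ThetaData.gmTable_eq_tableOf {G : Type u} [Monoid G] [MulSemiringAction G F] (Θ : ThetaData G F)
    (v w : V) : Θ.gmTable v w = tableOf Θ.x v w := rfl

/-- The `1`-cochain `A_R(v) = x_R − e_v` (`A_R(O) = 1`) of a point with abscissa `x_R`.
[cite: PoonenRains2012, Prop. 4.8 (the section of 𝒢(𝓛) over λ-division points of a rational point)] -/
def Aof (e : Fin 3 → F) (xR : F) (v : V) : F := if v = 0 then 1 else xR - e (idx v)

/-- The abscissa of the translate `R + T_v`: `x_R` for `v = O` and `eᵢ + Dᵢ/(x_R − eᵢ)` for `v = vᵢ`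
(the chord identity (T1)). [cite: SilvermanAEC2009, III.2.3 (translation by a 2-torsion point)] -/
def translAbsc (e : Fin 3 → F) (xR : F) (v : V) : F :=
  if v = 0 then xR else e (idx v) + Dof e (idx v) / (xR - e (idx v))

/-! ### The coboundary identity -/

/-- **`A_R(u) · A_{R+T_u}(w) · M(u, w) = A_R(u + w)`** for all `u, w` in the frame: the `Gm`-valued
theta cocycle on a Kummer cocycle is the coboundary of `A_R` (16 cases; the two non-trivial ones are
(T1) `(x_R − eᵢ)(x(R+Tᵢ) − eᵢ) = Dᵢ` and its consequence (T2)
`x(R+Tᵢ) − eⱼ = (eᵢ − eⱼ)(x_R − e_k)/(x_R − eᵢ)`).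
[cite: PoonenRains2012, Prop. 4.8 (isotropy of the Kummer image: q vanishes on δ(A(k)))] -/
theorem A_mul_A_mul_table {e : Fin 3 → F} (he : Function.Injective e) {xR : F} (hx : ∀ i, xR ≠ e i)
    (u w : V) :
    Aof e xR u * Aof e (translAbsc e xR u) w * tableOf e u w = Aof e xR (u + w) := by
  have h01 : e 0 - e 1 ≠ 0 := sub_ne_zero.mpr (he.ne (by decide))
  have h02 : e 0 - e 2 ≠ 0 := sub_ne_zero.mpr (he.ne (by decide))
  have h12 : e 1 - e 2 ≠ 0 := sub_ne_zero.mpr (he.ne (by decide))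
  have h10 : e 1 - e 0 ≠ 0 := sub_ne_zero.mpr (he.ne (by decide))
  have h20 : e 2 - e 0 ≠ 0 := sub_ne_zero.mpr (he.ne (by decide))
  have h21 : e 2 - e 1 ≠ 0 := sub_ne_zero.mpr (he.ne (by decide))
  have hx0 : xR - e 0 ≠ 0 := sub_ne_zero.mpr (hx 0)
  have hx1 : xR - e 1 ≠ 0 := sub_ne_zero.mpr (hx 1)
  have hx2 : xR - e 2 ≠ 0 := sub_ne_zero.mpr (hx 2)
  fin_cases u <;> fin_cases w <;>
    simp (config := { decide := true }) [Aof, translAbsc, tableOf, Dof, idx] <;> field_simp <;> ring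

/-! ### The sign identity -/

/-- **The sign identity**: with `sᵢ² = −Dᵢ`, `η(R+Tᵢ)(x_R − eᵢ) = −η(R)(x(R+Tᵢ) − eᵢ)` (Y) and
`x(R+Tᵢ) − eᵢ = Dᵢ/(x_R − eᵢ)` (T1): `sᵢ² · η(R) = (x_R − eᵢ)² · η(R+Tᵢ)`, i.e.
`(sᵢ/(x_R − eᵢ))² · η(R)/η(R+Tᵢ) = 1` — the cochain `ℓ(σ) = sᵢβ/((x_R − eᵢ)σβ)` (`β² = η(R)`,
`σβ² = η(R+Tᵢ)`) takes values in `μ₂`. [cite: PoonenRains2012, Prop. 4.8 (isotropy of the Kummer image)] -/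
theorem sq_eq_of_chord {e : Fin 3 → F} {xR s ηR ηT : F} (i : Fin 3) (hx : xR ≠ e i)
    (hs : s ^ 2 = -Dof e i) (hY : ηT * (xR - e i) = -(ηR * (translAbsc e xR (vec i) - e i))) :
    s ^ 2 * ηR = (xR - e i) ^ 2 * ηT := by
  have hx' : xR - e i ≠ 0 := sub_ne_zero.mpr hx
  have hv : vec i ≠ 0 := by fin_cases i <;> decide
  have hidx : idx (vec i) = i := by fin_cases i <;> decide
  simp only [translAbsc, hv, if_false, hidx, add_sub_cancel_left] at hY
  rw [hs]
  field_simp at hY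
  linear_combination -hY

/-- The sign identity in quotient form: `ℓ² = 1` for `ℓ = s β/((x_R − e) β′)` with `β² = η(R)`,
`β′² = η(R+T)` (`β′ = σβ`). [cite: PoonenRains2012, Prop. 4.8 (isotropy of the Kummer image)] -/
theorem div_sq_eq_one_of_chord {e : Fin 3 → F} {xR s ηR ηT β β' : F} (i : Fin 3) (hx : xR ≠ e i)
    (hs : s ^ 2 = -Dof e i) (hY : ηT * (xR - e i) = -(ηR * (translAbsc e xR (vec i) - e i)))
    (hβ : β ^ 2 = ηR) (hβ' : β' ^ 2 = ηT) (hη : ηT ≠ 0) :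
    (s * β / ((xR - e i) * β')) ^ 2 = 1 := by
  have key := sq_eq_of_chord i hx hs hY
  have hx' : xR - e i ≠ 0 := sub_ne_zero.mpr hx
  have hβ0 : β' ≠ 0 := fun h => hη (by rw [← hβ', h, zero_pow two_ne_zero])
  rw [div_pow, mul_pow, mul_pow, hβ, hβ', div_eq_one_iff_eq (mul_ne_zero (pow_ne_zero 2 hx') hη)]
  exact key

/-! ### From the curve: Vieta for the `2`-division cubic and the abscissa of `R + Tᵢ` -/

section Curve

variable {K : Type*} [Field K] (W : WeierstrassCurve K) (φ : K →+* F)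

/-- **Vieta for the `2`-division cubic**: if `Ψ = 4x³ + b₂x² + 2b₄x + b₆` has the three roots
`e₀, e₁, e₂` in `F` (`(Ψ.map φ).roots = {e₀,e₁,e₂}`, `4 ≠ 0` in `K`), then
`Ψ′(eᵢ) = 12eᵢ² + 2b₂eᵢ + 2b₄ = 4 Dᵢ = 4(eᵢ − eᵢ₊₁)(eᵢ − eᵢ₊₂)`.
[cite: SilvermanAEC2009, III.1 (the 2-division cubic 4x³ + b₂x² + 2b₄x + b₆)] -/
theorem vieta_D (h4 : (4 : K) ≠ 0) {e : Fin 3 → F}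
    (h3 : (Cubic.map φ W.twoTorsionPolynomial).roots = {e 0, e 1, e 2}) (i : Fin 3) :
    12 * e i ^ 2 + 2 * φ W.b₂ * e i + 2 * φ W.b₄ = 4 * Dof e i := by
  have ha : W.twoTorsionPolynomial.a ≠ 0 := h4
  have hb := Cubic.b_eq_three_roots (φ := φ) ha h3
  have hc := Cubic.c_eq_three_roots (φ := φ) ha h3
  simp only [twoTorsionPolynomial, map_ofNat, map_mul] at hb hc
  have hS : e i + e (i + 1) + e (i + 2) = e 0 + e 1 + e 2 := by
    fin_cases i <;> simp <;> ring
  have hP : e i * e (i + 1) + e i * e (i + 2) + e (i + 1) * e (i + 2) = e 0 * e 1 + e 0 * e 2 + e 1 * e 2 := by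
    fin_cases i <;> simp <;> ring
  simp only [Dof]
  linear_combination (2 * e i) * hb + hc + (8 * e i) * hS - 4 * hP

end Curve

end ThetaLevelTwo

end Literature.NumberTheory.EllipticCurves
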